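import Mathlib

/-!
# Stub `stub_tangencySets` of the crux `LevelOneGL2Designs` (stmt-MatrixMultiplication-14080) —
wall-breaker axis 10/12 (Hermitian unital constructions), part 2: the Hermitian SRS

`hermitian_srs` (the axis' theorem): in a finite field `F` with `q²` elements the affine
Hermitian curve `{(a,b) : b^q + b = a^{q+1}}` has `q³` points (`card_hermitian`, from the fibre
count `card_fiber_trace` of the trace-type map `b ↦ b^q + b`), and its tangent lines
`b' = a^q a' - b^q` meet it only at the point of tangency, because on the curve
`(a - a')(a - a')^q = 0` forces `a = a'`; with `u_{a,b} = (a^q/b^q, -1/b^q)` and `v_{a,b} = (a,b)`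
this is a strong representative system `u_f ⬝ᵥ v_{f'} = 1 ↔ f = f'` of size `q³ - 1 = |F|^{3/2} - 1`
(the origin is discarded).  Hence the statement of `stub_tangencySets` holds VERBATIM with the
prime field `ZMod p` replaced by a field of square order and `p` by the field order, constant
`1/2`, for every such field (`hermitian_srs_real`), in particular over `GaloisField p 2` for all
primes `p` (`tangencySets_sq_order`).  This is the affine part of the classical unital of
`PG(2,q²)` (the extremal configuration of the Illés–Szőnyi–Wettl bound `q√q + 1`).

What the axis does NOT give: `ZMod p` for `p` prime has no additive-and-multiplicative map
`σ ≠ id` with `σ ∘ σ = id` (its only ring endomorphism is the identity), so the identity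
`(x - a)(σ x - σ a) = N(x - a)` behind the tangency has no prime-field instance; the prime-order
case is the open window `(C·p log p, p√p + 1]` recorded in the crux's dead-line note.
Elementary finite-field algebra only (Frobenius additivity `add_pow_char_pow`, root counting
`Polynomial.card_roots'`); no new definitions.
-/

-- justification: the tree path `MatrixMultiplication/MatrixMultiplication` (summit = problem) makes every
-- declaration name contain a duplicated namespace segment, which this linter would flag.
set_option linter.dupNamespace false

noncomputable section

open scoped BigOperators
open Finset Matrix Polynomial

namespace Summit.MatrixMultiplication.MatrixMultiplication.Theorems.LevelOneGL2Designs.FlagLine.TangencyHermitian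

/-! ## The Hermitian curve over a field with `q²` elements -/

section Frobenius

variable {F : Type*} [Field F] [Fintype F]

/-- If `|F| = q²` then `q` is a power of the characteristic. [folklore] -/
theorem exists_char_pow (q : ℕ) (hF : Fintype.card F = q ^ 2) :
    ∃ (r m : ℕ), r.Prime ∧ CharP F r ∧ q = r ^ m := by
  obtain ⟨r, hchar, n, hr, hcard⟩ := FiniteField.card' F
  have hdvd : q ∣ r ^ (n : ℕ) := by
    rw [← hcard, hF, pow_two]
    exact dvd_mul_right q q
  obtain ⟨m, -, hm⟩ := (Nat.dvd_prime_pow hr).1 hdvd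
  exact ⟨r, m, hr, hchar, hm⟩

/-- If `|F| = q²` then `2 ≤ q`. [folklore] -/
theorem two_le_of_card_eq_sq (q : ℕ) (hF : Fintype.card F = q ^ 2) : 2 ≤ q := by
  have h1 : 1 < Fintype.card F := Fintype.one_lt_card
  rw [hF] at h1
  by_contra h
  push Not at h
  interval_cases q <;> simp at h1

/-- The `q`-power map of a field with `q²` elements is additive. [folklore] -/
theorem qpow_add (q : ℕ) (hF : Fintype.card F = q ^ 2) (x y : F) :
    (x + y) ^ q = x ^ q + y ^ q := by
  obtain ⟨r, m, hr, hchar, rfl⟩ := exists_char_pow q hF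
  haveI := Fact.mk hr
  exact add_pow_char_pow x y r m

/-- The `q`-power map of a field with `q²` elements respects subtraction. [folklore] -/
theorem qpow_sub (q : ℕ) (hF : Fintype.card F = q ^ 2) (x y : F) :
    (x - y) ^ q = x ^ q - y ^ q := by
  obtain ⟨r, m, hr, hchar, rfl⟩ := exists_char_pow q hF
  haveI := Fact.mk hr
  exact sub_pow_char_pow x y m

/-- The `q`-power map of a field with `q²` elements is an involution: `(x^q)^q = x^{q²} = x`.
[folklore] -/
theorem qpow_qpow (q : ℕ) (hF : Fintype.card F = q ^ 2) (x : F) : (x ^ q) ^ q = x := by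
  rw [← pow_mul, ← pow_two, ← hF]
  exact FiniteField.pow_card x

end Frobenius

section Hermitian

variable {F : Type*} [Field F] [Fintype F] [DecidableEq F]

/-- Root count: for `ε ≠ 0` and `2 ≤ q` the equation `x^q + ε x = 0` has at most `q` solutions
in the field `F` (roots of the nonzero polynomial `X^q + C ε * X` of degree `q`). [folklore] -/
theorem card_filter_pow_add_mul_le (q : ℕ) (hq : 2 ≤ q) (ε : F) (hε : ε ≠ 0) :
    (univ.filter fun x : F => x ^ q + ε * x = 0).card ≤ q := by
  set P : F[X] := X ^ q + C ε * X with hP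
  have hdeg : P.natDegree = q := by
    rw [hP, natDegree_add_eq_left_of_natDegree_lt] <;>
      rw [natDegree_X_pow]
    rw [natDegree_C_mul_X ε hε]
    omega
  have hP0 : P ≠ 0 := by
    apply ne_zero_of_natDegree_gt (n := 1)
    rw [hdeg]
    omega
  calc (univ.filter fun x : F => x ^ q + ε * x = 0).card
      ≤ P.roots.toFinset.card := by
        apply card_le_card
        intro x hx
        rw [mem_filter] at hx
        rw [Multiset.mem_toFinset, mem_roots hP0, IsRoot.def, hP]
        simp only [eval_add, eval_pow, eval_X, eval_mul, eval_C]
        exact hx.2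
    _ ≤ Multiset.card P.roots := Multiset.toFinset_card_le _
    _ ≤ P.natDegree := card_roots' P
    _ = q := hdeg

/-- **Fibres of the trace-type map `b ↦ b^q + b`.**  In a field with `q²` elements, for every `c`
with `c^q = c` the equation `b^q + b = c` has exactly `q` solutions.  Proof by double counting:
the map lands in `K = {c : c^q = c}` (`|K| ≤ q`), its non-empty fibres are translates of the
kernel `Z = {b : b^q + b = 0}` (`|Z| ≤ q`), and `q² = |F| = Σ_{c ∈ K} |fibre c| ≤ |K|·|Z| ≤ q²`
forces every fibre over `K` to have exactly `q` elements. [folklore] -/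
theorem card_fiber_trace (q : ℕ) (hF : Fintype.card F = q ^ 2) (c : F) (hc : c ^ q = c) :
    (univ.filter fun b : F => b ^ q + b = c).card = q := by
  have hq2 : 2 ≤ q := two_le_of_card_eq_sq q hF
  set Z := univ.filter fun b : F => b ^ q + b = 0 with hZdef
  set K := univ.filter fun c : F => c ^ q = c with hKdef
  set fib := fun c : F => univ.filter fun b : F => b ^ q + b = c with hfibdef
  have hZ : Z.card ≤ q := by
    have := card_filter_pow_add_mul_le (F := F) q hq2 1 one_ne_zero
    simpa only [one_mul] using this
  have hK : K.card ≤ q := by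
    have h := card_filter_pow_add_mul_le (F := F) q hq2 (-1) (neg_ne_zero.2 one_ne_zero)
    have heq : (univ.filter fun x : F => x ^ q + -1 * x = 0) = K := by
      ext x
      simp only [hKdef, mem_filter, mem_univ, true_and, neg_one_mul, ← sub_eq_add_neg, sub_eq_zero]
    rwa [heq] at h
  have hfib_le : ∀ c, (fib c).card ≤ Z.card := by
    intro c
    by_cases hne : (fib c).Nonempty
    · obtain ⟨b₀, hb₀⟩ := hne
      have hb₀' : b₀ ^ q + b₀ = c := by
        simpa only [hfibdef, mem_filter, mem_univ, true_and] using hb₀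
      have hsub : fib c ⊆ Z.image fun z => z + b₀ := by
        intro b hb
        have hb' : b ^ q + b = c := by
          simpa only [hfibdef, mem_filter, mem_univ, true_and] using hb
        refine mem_image.2 ⟨b - b₀, ?_, sub_add_cancel b b₀⟩
        simp only [hZdef, mem_filter, mem_univ, true_and]
        rw [qpow_sub q hF]
        linear_combination hb' - hb₀'
      exact (card_le_card hsub).trans card_image_le
    · rw [not_nonempty_iff_eq_empty.1 hne, card_empty]
      exact Nat.zero_le _
  have hmaps : ∀ b ∈ (univ : Finset F), b ^ q + b ∈ K := by
    intro b _
    simp only [hKdef, mem_filter, mem_univ, true_and]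
    rw [qpow_add q hF, qpow_qpow q hF, add_comm]
  have hsum : Fintype.card F = ∑ c ∈ K, (fib c).card := by
    rw [← Finset.card_univ]
    exact Finset.card_eq_sum_card_fiberwise hmaps
  have hle1 : ∑ c ∈ K, (fib c).card ≤ K.card * Z.card := by
    calc ∑ c ∈ K, (fib c).card ≤ ∑ _c ∈ K, Z.card := Finset.sum_le_sum fun c _ => hfib_le c
      _ = K.card * Z.card := by rw [sum_const, smul_eq_mul]
  have hZq : Z.card = q := by
    apply le_antisymm hZ
    have h : q * q ≤ q * Z.card := by
      calc q * q = q ^ 2 := (pow_two q).symm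
        _ = Fintype.card F := hF.symm
        _ = ∑ c ∈ K, (fib c).card := hsum
        _ ≤ K.card * Z.card := hle1
        _ ≤ q * Z.card := Nat.mul_le_mul_right _ hK
    exact Nat.le_of_mul_le_mul_left h (by omega)
  by_contra hcon
  have hcK : c ∈ K := by
    simp only [hKdef, mem_filter, mem_univ, true_and]
    exact hc
  have hlt : (fib c).card < Z.card := lt_of_le_of_ne (hfib_le c) (by rwa [hZq])
  have hsumlt : ∑ c ∈ K, (fib c).card < ∑ _c ∈ K, Z.card :=
    Finset.sum_lt_sum (fun c _ => hfib_le c) ⟨c, hcK, hlt⟩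
  rw [sum_const, smul_eq_mul, ← hsum, hF, hZq] at hsumlt
  have := lt_of_lt_of_le hsumlt (Nat.mul_le_mul_right q hK)
  rw [pow_two] at this
  exact lt_irrefl _ this

/-- **The affine Hermitian curve has `q³` points**: `#{(a,b) ∈ F² : b^q + b = a^{q+1}} = q³`
when `|F| = q²` — over each `a` the fibre has `q` points (`card_fiber_trace`, as
`(a^{q+1})^q = a^{q+1}`). [folklore] -/
theorem card_hermitian (q : ℕ) (hF : Fintype.card F = q ^ 2) :
    (univ.filter fun ab : F × F => ab.2 ^ q + ab.2 = ab.1 ^ (q + 1)).card = q ^ 3 := by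
  have hfix : ∀ a : F, (a ^ (q + 1)) ^ q = a ^ (q + 1) := by
    intro a
    rw [pow_succ, mul_pow, qpow_qpow q hF, mul_comm]
  have hfib : ∀ a : F, (univ.filter fun b : F => b ^ q + b = a ^ (q + 1)).card = q :=
    fun a => card_fiber_trace q hF _ (hfix a)
  calc (univ.filter fun ab : F × F => ab.2 ^ q + ab.2 = ab.1 ^ (q + 1)).card
      = ∑ ab : F × F, (if ab.2 ^ q + ab.2 = ab.1 ^ (q + 1) then 1 else 0) :=
        Finset.card_filter _ _
    _ = ∑ a : F, ∑ b : F, (if b ^ q + b = a ^ (q + 1) then 1 else 0) :=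
        Fintype.sum_prod_type _
    _ = ∑ a : F, (univ.filter fun b : F => b ^ q + b = a ^ (q + 1)).card := by
        simp_rw [Finset.card_filter]
    _ = ∑ _a : F, q := Finset.sum_congr rfl fun a _ => hfib a
    _ = q ^ 3 := by
        rw [sum_const, smul_eq_mul, card_univ, hF]
        ring

/-- **Hermitian strong representative system** (the axis' theorem).  If `|F| = q²`, the flags
`(u_{a,b}, v_{a,b})` with `v_{a,b} = (a, b)` a point of the affine Hermitian curve
`b^q + b = a^{q+1}` other than the origin and `u_{a,b} = (a^q / b^q, -1/b^q)` the normal form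
of its tangent line `b' = a^q a' - b^q` satisfy `u_f ⬝ᵥ v_{f'} = 1 ↔ f = f'`, and there are
`q³ - 1` of them.  Key step: if the tangent at `(a,b)` passes through the curve point `(a',b')`
then applying the `q`-power map and the two curve equations gives `(a - a')^{q+1} = 0`.
This is the affine part of the classical unital (Hermitian curve) of `PG(2,q²)`, whose
tangent lines meet it in one point each. [folklore] -/
theorem hermitian_srs (q : ℕ) (hF : Fintype.card F = q ^ 2) :
    ∃ S : Finset ((Fin 2 → F) × (Fin 2 → F)), S.card = q ^ 3 - 1 ∧
      ∀ f ∈ S, ∀ f' ∈ S, (f.1 ⬝ᵥ f'.2 = 1 ↔ f = f') := by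
  have hq2 : 2 ≤ q := two_le_of_card_eq_sq q hF
  have hq0 : q ≠ 0 := by omega
  set H := univ.filter fun ab : F × F => ab.2 ^ q + ab.2 = ab.1 ^ (q + 1) with hH
  let Φ : F × F → (Fin 2 → F) × (Fin 2 → F) := fun ab =>
    (![ab.1 ^ q * (ab.2 ^ q)⁻¹, -(ab.2 ^ q)⁻¹], ![ab.1, ab.2])
  have hΦ : Function.Injective Φ := by
    rintro ⟨a, b⟩ ⟨a', b'⟩ h
    have h2 := congrArg Prod.snd h
    have ha := congrFun h2 0
    have hb := congrFun h2 1
    simp only [Φ, Matrix.cons_val_zero, Matrix.cons_val_one, Matrix.cons_val_fin_one] at ha hb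
    rw [ha, hb]
  have h0 : ((0 : F), (0 : F)) ∈ H := by
    simp [hH, zero_pow hq0]
  refine ⟨(H.erase (0, 0)).image Φ, ?_, ?_⟩
  · rw [card_image_of_injective _ hΦ, card_erase_of_mem h0, card_hermitian q hF]
  · simp only [mem_image, mem_erase]
    rintro f ⟨⟨a, b⟩, ⟨hab0, habH⟩, rfl⟩ f' ⟨⟨a', b'⟩, ⟨-, habH'⟩, rfl⟩
    simp only [hH, mem_filter, mem_univ, true_and] at habH habH'
    rw [pow_succ] at habH habH'
    have hb : b ≠ 0 := by
      rintro rfl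
      apply hab0
      simp only [zero_pow hq0, add_zero] at habH
      have ha : a = 0 := by
        rcases mul_eq_zero.1 habH.symm with h | h
        · exact (pow_eq_zero_iff hq0).1 h
        · exact h
      rw [ha]
    have hbq : b ^ q ≠ 0 := pow_ne_zero _ hb
    rw [hΦ.eq_iff]
    simp only [Φ, vec2_dotProduct, Matrix.cons_val_zero, Matrix.cons_val_one,
      Matrix.cons_val_fin_one]
    constructor
    · intro h
      have key : b' = a ^ q * a' - b ^ q := by
        field_simp at h
        linear_combination -h
      have key' : b' ^ q = a * a' ^ q - b := by
        rw [key, qpow_sub q hF, mul_pow, qpow_qpow q hF, qpow_qpow q hF]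
      have h3 : (a - a') ^ (q + 1) = 0 := by
        rw [pow_succ, qpow_sub q hF]
        linear_combination key + key' - habH - habH'
      have haa : a = a' := sub_eq_zero.1 ((pow_eq_zero_iff (Nat.succ_ne_zero q)).1 h3)
      subst haa
      have hbb : b' = b := by
        rw [key]
        linear_combination -habH
      rw [hbb]
    · intro h
      rw [Prod.mk.injEq] at h
      obtain ⟨rfl, rfl⟩ := h
      field_simp
      linear_combination -habH

/-- `hermitian_srs` with the size measured as in the stub: `(1/2)·|F|^{3/2} ≤ |S|` (as
`q³ - 1 ≥ q³/2`).  This is `stub_tangencySets` with the prime field `ZMod p` replaced by any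
finite field of square order and `p` by the field order. [folklore] -/
theorem hermitian_srs_real (q : ℕ) (hF : Fintype.card F = q ^ 2) :
    ∃ S : Finset ((Fin 2 → F) × (Fin 2 → F)),
      (1 / 2 : ℝ) * (Fintype.card F : ℝ) ^ (3 / 2 : ℝ) ≤ S.card ∧
      ∀ f ∈ S, ∀ f' ∈ S, (f.1 ⬝ᵥ f'.2 = 1 ↔ f = f') := by
  obtain ⟨S, hS, hsrs⟩ := hermitian_srs q hF
  refine ⟨S, ?_, hsrs⟩
  have hq2 : 2 ≤ q := two_le_of_card_eq_sq q hF
  have hq : (2 : ℝ) ≤ q := by exact_mod_cast hq2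
  have hrpow : ((q ^ 2 : ℕ) : ℝ) ^ (3 / 2 : ℝ) = (q : ℝ) ^ 3 := by
    push_cast
    rw [← Real.rpow_natCast (q : ℝ) 2, ← Real.rpow_mul (by positivity), ← Real.rpow_natCast]
    norm_num
  rw [hF, hrpow, hS]
  have h1 : 1 ≤ q ^ 3 := Nat.one_le_pow _ _ (by omega)
  have h8 : (8 : ℝ) ≤ (q : ℝ) ^ 3 := by
    have := pow_le_pow_left₀ (by norm_num : (0 : ℝ) ≤ 2) hq 3
    norm_num at this
    exact this
  push_cast [Nat.cast_sub h1]
  linarith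

/-- **The stub over fields of order `p²`.**  For every `p₀` there is a prime `p ≥ p₀` and a
strong representative system `S` of the affine plane over `GaloisField p 2` (the field with
`p²` elements) with `|S| ≥ (1/2)·(p²)^{3/2}` — the statement of `stub_tangencySets` with
`ZMod p` replaced by `GaloisField p 2` and sizes measured against the field order, for ALL
primes.  Witness: the Hermitian curve (`hermitian_srs`). [folklore] -/
theorem tangencySets_sq_order (p₀ : ℕ) : ∃ (p : ℕ) (_ : Fact p.Prime), p₀ ≤ p ∧
    ∃ S : Finset ((Fin 2 → GaloisField p 2) × (Fin 2 → GaloisField p 2)),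
      (1 / 2 : ℝ) * ((p : ℝ) ^ 2) ^ (3 / 2 : ℝ) ≤ S.card ∧
      ∀ f ∈ S, ∀ f' ∈ S, (f.1 ⬝ᵥ f'.2 = 1 ↔ f = f') := by
  classical
  obtain ⟨p, hp₀, hp⟩ := Nat.exists_infinite_primes p₀
  haveI : Fact p.Prime := ⟨hp⟩
  letI : Fintype (GaloisField p 2) := Fintype.ofFinite _
  have hcard : Fintype.card (GaloisField p 2) = p ^ 2 := by
    rw [← Nat.card_eq_fintype_card]
    exact GaloisField.card p 2 two_ne_zero
  obtain ⟨S, hS, hsrs⟩ := hermitian_srs_real (F := GaloisField p 2) p hcard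
  refine ⟨p, ‹_›, hp₀, S, ?_, hsrs⟩
  rw [hcard] at hS
  push_cast at hS
  exact hS

end Hermitian

end Summit.MatrixMultiplication.MatrixMultiplication.Theorems.LevelOneGL2Designs.FlagLine.TangencyHermitian
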